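import Summits.ResolutionOfSingularities.ResolutionOfSingularities.Theses.Valuative
import Summits.ResolutionOfSingularities.ResolutionOfSingularities.Theorems.ValuativeTorsorToLurelPerfectDescent
import Summits.ResolutionOfSingularities.ResolutionOfSingularities.Theorems.ValuativeTorsorToLurelTowerAbsorb
import Summits.ResolutionOfSingularities.ResolutionOfSingularities.Theorems.ValuativeTorsorToLurelFfiniteGenerators

/-!
# `Valuative.TorsorToLurel` from its `F`-finite special case (Temkin's reduction for every `k`)

Route `ResolutionOfSingularities/Valuative`, crux `TorsorToLurel`
(stmt-ResolutionOfSingularities-10968): local uniformization of `α_p`-torsors over bases regular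
at the centre (the crux `LuAlphaPTorsor` at the prime `p`, all ground fields of characteristic
`p`) implies RELATIVE local uniformization `LUrel_p` over EVERY ground field `k` of
characteristic `p`.

* `torsorToLurel_of_torsorToLurelFfinite` — **the transfer, unconditional**: the route item
  `TorsorToLurelFfinite` (the same statement for `[k : k^p] < ∞`, Temkin 2013 Rem. 1.3.5 (ii)
  verbatim) implies `TorsorToLurel`. Proof = the perfect-closure sandwich
  (`stub_ttlPerfectDescent`, file `ValuativeTorsorToLurelPerfectDescent`): run the `F`-finite
  sibling over the PERFECT closure `k'` of `k` (perfect fields are `F`-finite,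
  `moduleFinite_frobeniusRange_of_perfectField`), push the chart into `K` by Frobenius, DESCEND
  regularity to `k` along the free base change `B → B ⊗ₖ k'` (Mac Lane linear disjointness of the
  separable Frobenius layer + Matsumura 23.7 (i)), then climb `k(B) ⊆ K` with the torsor
  hypothesis and absorb `R` by normality (`stub_ttlTowerAbsorb`). Hence
  `torsorToLurel_iff_torsorToLurelFfinite`: the two route items are ONE obligation.
* `torsorToLurel_of_perfectLU` — the minimal input isolated: relative local uniformization over
  PERFECT ground fields (given the torsor hypothesis) already implies the crux.
* The CONDITIONAL corollaries through the in-tree `torsorToLurelFfinite_of_temkin2013Relative`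
  (the crux modulo Temkin 2013, Thm. 1.3.2 = Literature fact `Temkin2013Relative`, i.e. modulo
  the single remaining leaf `Temkin2013RelativeCurveSmoothFibre`) live in the companion file
  `ValuativeTorsorToLurelOfTemkin.lean`, so that this file does not import the Temkin cone.

No smoothness transport and no `F`-finiteness are used anywhere; the barrier
`Literature.Barriers.ResolutionOfSingularities.InseparableBaseChange` (regular ≠ geometrically
regular) is evaded by direction: regularity is only ever DESCENDED along a flat base change.
-/

noncomputable section

set_option linter.dupNamespace false -- mandated namespace of this single-conjunct summit

open IsLocalRing

namespace Summit.ResolutionOfSingularities.ResolutionOfSingularities.Theorems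

/-- **Perfect fields are `F`-finite**: `k` is a finite module over the image `k^p` of Frobenius
(indeed `k^p = k`). -/
theorem moduleFinite_frobeniusRange_of_perfectField (k : Type) [Field k] (p : ℕ) [Fact p.Prime]
    [CharP k p] [PerfectField k] : Module.Finite (frobenius k p).range k := by
  haveI : PerfectRing k p := PerfectField.toPerfectRing p
  have hsurj : Function.Surjective (frobenius k p) := surjective_frobenius k p
  refine ⟨⟨{1}, ?_⟩⟩
  rw [eq_top_iff]
  rintro x -
  obtain ⟨y, hy⟩ := hsurj x
  have hx : x = (⟨x, y, hy⟩ : (frobenius k p).range) • (1 : k) := by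
    rw [Subring.smul_def, smul_eq_mul, mul_one]
  rw [hx]
  exact Submodule.smul_mem _ _ (Submodule.subset_span (by simp))

/-- **Relative local uniformization over PERFECT ground fields from the `F`-finite sibling**:
the route item `TorsorToLurelFfinite` applies verbatim over a perfect `k`. -/
theorem perfectLU_of_torsorToLurelFfinite
    (hC : Summit.ResolutionOfSingularities.ResolutionOfSingularities.Theses.Valuative.TorsorToLurelFfinite)
    (p : ℕ) [Fact p.Prime]
    (hT : ∀ (k K : Type) [Field k] [CharP k p] [Field K] [Algebra k K] (O : ValuationSubring K)
      (A₀ : Subalgebra k K) (h₀ : A₀.toSubring ≤ O.toSubring) (t : K), A₀.FG → t ^ p ∈ A₀ →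
      IsFractionRing (Algebra.adjoin k (insert t (A₀ : Set K))) K →
      IsRegularLocalRing (Localization.AtPrime
        (Ideal.comap (Subring.inclusion h₀) (maximalIdeal O))) →
      ∃ (A : Subalgebra k K) (h : A.toSubring ≤ O.toSubring), A₀ ≤ A ∧ t ∈ A ∧ A.FG ∧
        IsFractionRing A K ∧
        IsRegularLocalRing (Localization.AtPrime
          (Ideal.comap (Subring.inclusion h) (maximalIdeal O))))
    (k K : Type) [Field k] [CharP k p] [PerfectField k] [Field K] [Algebra k K]
    (hfg : (⊤ : IntermediateField k K).FG) (O : ValuationSubring K)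
    (hO : ∀ c : k, algebraMap k K c ∈ O) (R : Subalgebra k K) (hRfg : R.FG)
    (hRO : R.toSubring ≤ O.toSubring) :
    ∃ (A : Subalgebra k K) (h : A.toSubring ≤ O.toSubring), R ≤ A ∧ A.FG ∧ IsFractionRing A K ∧
      IsRegularLocalRing (Localization.AtPrime
        (Ideal.comap (Subring.inclusion h) (maximalIdeal O))) :=
  hC p hT k K (moduleFinite_frobeniusRange_of_perfectField k p) hfg O hO R hRfg hRO

/-- **The transfer `TorsorToLurelFfinite → TorsorToLurel`** (Temkin's reduction for every ground
field of characteristic `p` from its `F`-finite special case): by the perfect-closure sandwich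
(`stub_ttlPerfectDescent`) applied to local uniformization over the perfect closure of `k`, and
the torsor tower with absorption (`stub_ttlTowerAbsorb`) over `k` itself. Unconditional. -/
theorem torsorToLurel_of_torsorToLurelFfinite
    (hC : Summit.ResolutionOfSingularities.ResolutionOfSingularities.Theses.Valuative.TorsorToLurelFfinite) :
    Summit.ResolutionOfSingularities.ResolutionOfSingularities.Theses.Valuative.TorsorToLurel := by
  intro p hp hT k K _ _ _ _ hfg O hO R hRfg hRO
  haveI : Fact p.Prime := ⟨hp⟩
  obtain ⟨m, A₀, h₀, hA₀fg, hRpow, hKpow, hreg₀⟩ :=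
    stub_ttlPerfectDescent p
      (fun k' K' _ _ _ _ _ => perfectLU_of_torsorToLurelFfinite hC p hT k' K') k K hfg O hO R hRfg hRO
  obtain ⟨G, hGO, hGtop⟩ := exists_finset_generators_mem k K hfg O
  exact stub_ttlTowerAbsorb p hT k K O R hRfg hRO G hGO hGtop m A₀ h₀ hA₀fg hreg₀ hRpow
    (fun g _ => hKpow g)

/-- **The crux from local uniformization over PERFECT ground fields** (the minimal input of the
line): if the torsor hypothesis at `p` yields relative local uniformization over every perfect
ground field of characteristic `p`, then it yields it over every ground field of characteristic
`p` (perfect-closure sandwich + torsor tower + absorption). Unconditional. -/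
theorem torsorToLurel_of_perfectLU
    (hLU : ∀ (p : ℕ) [Fact p.Prime],
      (∀ (k K : Type) [Field k] [CharP k p] [Field K] [Algebra k K] (O : ValuationSubring K)
        (A₀ : Subalgebra k K) (h₀ : A₀.toSubring ≤ O.toSubring) (t : K), A₀.FG → t ^ p ∈ A₀ →
        IsFractionRing (Algebra.adjoin k (insert t (A₀ : Set K))) K →
        IsRegularLocalRing (Localization.AtPrime
          (Ideal.comap (Subring.inclusion h₀) (maximalIdeal O))) →
        ∃ (A : Subalgebra k K) (h : A.toSubring ≤ O.toSubring), A₀ ≤ A ∧ t ∈ A ∧ A.FG ∧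
          IsFractionRing A K ∧
          IsRegularLocalRing (Localization.AtPrime
            (Ideal.comap (Subring.inclusion h) (maximalIdeal O)))) →
      ∀ (k K : Type) [Field k] [CharP k p] [PerfectField k] [Field K] [Algebra k K],
        (⊤ : IntermediateField k K).FG → ∀ O : ValuationSubring K,
        (∀ c : k, algebraMap k K c ∈ O) → ∀ R : Subalgebra k K, R.FG →
        R.toSubring ≤ O.toSubring →
        ∃ (A : Subalgebra k K) (h : A.toSubring ≤ O.toSubring), R ≤ A ∧ A.FG ∧
          IsFractionRing A K ∧
          IsRegularLocalRing (Localization.AtPrime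
            (Ideal.comap (Subring.inclusion h) (maximalIdeal O)))) :
    Summit.ResolutionOfSingularities.ResolutionOfSingularities.Theses.Valuative.TorsorToLurel := by
  intro p hp hT k K _ _ _ _ hfg O hO R hRfg hRO
  haveI : Fact p.Prime := ⟨hp⟩
  obtain ⟨m, A₀, h₀, hA₀fg, hRpow, hKpow, hreg₀⟩ :=
    stub_ttlPerfectDescent p (fun k' K' _ _ _ _ _ => hLU p hT k' K') k K hfg O hO R hRfg hRO
  obtain ⟨G, hGO, hGtop⟩ := exists_finset_generators_mem k K hfg O
  exact stub_ttlTowerAbsorb p hT k K O R hRfg hRO G hGO hGtop m A₀ h₀ hA₀fg hreg₀ hRpow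
    (fun g _ => hKpow g)

/-- **`TorsorToLurel ↔ TorsorToLurelFfinite`**: the crux for every ground field and its `F`-finite
special case are ONE obligation (the forward direction just drops the hypothesis `[k : k^p] < ∞`,
cf. `torsorToLurelFfinite_of_torsorToLurel` in `ValuativeTorsorToLurelFfinite.lean`). -/
theorem torsorToLurel_iff_torsorToLurelFfinite :
    Summit.ResolutionOfSingularities.ResolutionOfSingularities.Theses.Valuative.TorsorToLurel ↔
      Summit.ResolutionOfSingularities.ResolutionOfSingularities.Theses.Valuative.TorsorToLurelFfinite :=
  ⟨fun h p _ hT k K _ _ _ _ _ hfg O hO R hRfg hRO => h p Fact.out hT k K hfg O hO R hRfg hRO,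
    torsorToLurel_of_torsorToLurelFfinite⟩

end Summit.ResolutionOfSingularities.ResolutionOfSingularities.Theorems

end
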